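import Mathlib
import Literature.Computability.Complexity.RandomizedProofs
import Literature.Computability.Complexity.StackWordArith
import HarnessLib

/-!
# PureCubicClassNumberModThree

Topic `Literature/NumberTheory/NumberFields`. Named literature fact(s) relocated by the gate from `Summits/QuantumAdvantage/QuantumAdvantage/Theorems/LinnikCubicClassGroupsPureCubicClassNumberHardHondaLeakTransfer.lean`
(accept-time relocation of `[cite]`d propositions written inline in a Summits proposal; human ruling 2026-08-15).
Sources: AouissiMayerIsmailiTalbiAzizi2020.

* `Literature.NumberTheory.NumberFields.Honda1971_three_dvd_classNumber_twoPrimes`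
-/

namespace Literature.NumberTheory.NumberFields

open Literature.Computability.Complexity _root_.Computability NumberField

/-- **Honda's criterion for `3 ∣ h(ℚ(∛d))`, case `d = pq ≡ ±1 (mod 9)`.** For distinct primes
`p, q` with `pq ≡ ±1 (mod 9)` (so `p, q ≠ 3`; the pure cubic field `L = ℚ(∛(pq))` is of Dedekind's
second species and the conductor of `L(ζ₃)/ℚ(ζ₃)` is `f = pq`, [AouissiMayerIsmailiTalbiAzizi2020,
eq. (2.1)]) and every cubic number field `K ∋ ∛(pq)` (all `≅ L`): `3 ∤ h_K` iff
`p ≡ 2, 5 (mod 9)` and `q ≡ 2, 5 (mod 9)` — by [AouissiMayerIsmailiTalbiAzizi2020, Thm. 2.3]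
(`3 ∤ h_L` iff `f` is one of `9`, `q₁ ≡ 8 (9)`, `3q₁`, `9q₁`, `q₁q₂` with `q_j ≡ 2, 5 (mod 9)`;
for `f = pq` only item (5) can occur), originally Honda 1971, Theorem, cases (iv)–(v) (Chevalley's
ambiguous class number formula for the cyclic cubic extension `L(ζ₃)/ℚ(ζ₃)`). Stated here as the
equivalent `3 ∣ h_K ↔ ¬(…)`, in the special case the quantum-advantage line needs (general form:
all cube-free radicands, five conductor shapes, ibid. Thm. 2.3 (1)–(5)).
[cite: AouissiMayerIsmailiTalbiAzizi2020, Thm. 2.3 with eq. (2.1)]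
[file NumberTheory/NumberFields/PureCubicClassNumberModThree] -/
def Honda1971_three_dvd_classNumber_twoPrimes : Prop :=
  ∀ p q : ℕ, p.Prime → q.Prime → p ≠ q → ((p * q) % 9 = 1 ∨ (p * q) % 9 = 8) →
    ∀ (K : Type) [Field K] [NumberField K], Module.finrank ℚ K = 3 →
      (∃ α : K, α ^ 3 = ((p * q : ℕ) : K)) →
        (3 ∣ NumberField.classNumber K ↔ ¬ ((p % 9 = 2 ∨ p % 9 = 5) ∧ (q % 9 = 2 ∨ q % 9 = 5)))
-- TODO(general form): Honda's criterion for every cube-free radicand `d` — `3 ∤ h(ℚ(∛d))` iff the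
-- conductor `f` of `ℚ(∛d, ζ₃)/ℚ(ζ₃)` is one of `9`, `q₁ ≡ 8 (9)`, `3 q₁`, `9 q₁`, `q₁ q₂` with
-- `q_j ≡ 2, 5 (mod 9)` [AouissiMayerIsmailiTalbiAzizi2020, Thm. 2.3 (1)–(5)]; needs the conductor
-- `f(d)` (ibid. eq. (2.2)) as a function of the radicand.

/-! ### The window `2|x|+8` returns all of `h_K` -/

end Literature.NumberTheory.NumberFields
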